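import Literature.Analysis.FluidPDE.SawtoothCascadeProfileHigherDerivatives
import HarnessLib

/-!
# Derivative caps of the cascade carrier vorticity and of one-coordinate profiles on `T^d`

Proofs-layer sequel of `SawtoothCascadeResponseVorticity.lean` / `SawtoothCascadeProfileHigherDerivatives.lean`
(cell `ad-ideate`, route SawtoothPulseCascade; theorems only, no definitions, no named facts). For a
`1`-periodic profile read on one coordinate, `F(x) = ψ(x_k)` on `T^d`:

* `partialDeriv_coordFun_eq` — `∂ₘF = 𝟙[m = k] ψ′(x_k)` as functions; iterated:
  `partialDeriv_partialDeriv_coordFun_eq`, `partialDeriv³`; sup bounds `abs_partialDeriv_coordFun_le`,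
  `abs_partialDeriv_partialDeriv_coordFun_le`, `abs_partialDeriv3_coordFun_le` from `sup|ψ′|, sup|ψ″|, sup|ψ‴|`;
* `sqrt_scalarGradNormSq_coordFun_le`, `sqrt_sum_partialDeriv_partialDeriv_coordFun_sq_le` — on the unit
  torus `‖∇F‖₂ ≤ sup|ψ′|`, `(∑ᵢₘ‖∂ᵢ∂ₘF‖₂²)^{1/2} ≤ sup|ψ″|` (only the `(k,k)` entry is nonzero);
* the cascade carrier on an `H` half-slot of phase `j`: `Ω̄(t,x) = −rateH j t · U_j′(x₂)`
  (`torusVorticityTensor_field_of_mem_H`), hence with the caps of `SawtoothCascadeProfileCurvature` /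
  `…HigherDerivatives`: `|∂ₘΩ̄| ≤ |rateH| · 2√(2π)N_j/δ_j`, `|∂ᵢ∂ₘΩ̄| ≤ |rateH| · 2(2πN_j)²/δ_j²`,
  `|∂ₗ∂ᵢ∂ₘΩ̄| ≤ |rateH| · 10(2πN_j)³/(δ_j³√(2π))` (`abs_partialDeriv{,2,3}_vorticity_field_le_of_mem_H`;
  `V` half-slots alike with `x₁`, `rateV`).

* (Amendment 1, §4) the viscous force `g = ν Δū` on the half-slots: `laplacian_field_of_mem_H/_V`
  (`Δū = rate·U_j″(x_k) e`), `vorticity_viscousForce_eq_coordFun_of_mem_H/_V` (`c = ∂₀g₁ − ∂₁g₀ = ∓ν·rate·U_j‴(x_k)`),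
  `vorticity_viscousForce_sizes_of_mem_H/_V` (`‖∇c‖₂ ≤ |ν rate|·10(2πN_j)³/(δ_j³√(2π))`, `(∑‖∂ᵢ∂ₘc‖₂²)^{1/2} ≤ |ν rate|·12(2πN_j)⁴/δ_j⁴`).
* (Amendment 2, §5) smoothness in `x` on the half-slots: `isSmooth_field_of_mem_H/_V`, `isSmooth_vorticity_field_of_mem_H/_V`,
  `isSmooth_viscousForce_of_mem_H/_V`, `isSmooth_vorticity_viscousForce_of_mem_H/_V`.
* (Amendment 3, §6) the carrier's velocity-gradient caps on the half-slots: `partialDeriv_field_eq_of_mem_H/_V`,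
  `partialDeriv_partialDeriv_field_eq_of_mem_H/_V`, `norm_partialDeriv_field_le_of_mem_H/_V` (`‖∂ₖū‖ ≤ |rate|`),
  `norm_partialDeriv_partialDeriv_field_le_of_mem_H/_V` (`‖∂ᵢ∂ₖū‖ ≤ |rate|·2√(2π)N_j/δ_j`) — the `Λ`, `L₂` of the capstones.

These are the constants `K₁, K₂, K₃` of `TorusLinearisedNSVorticityGradientGrowth`
(`sqrt_scalarGradNormSq_vorticitySource_le_fin_two`, `sqrt_sum_vorticitySource_le_fin_two`) for the
cascade, and — with `ψ = −ν·rate·U_j‴` — the force-part sizes `‖∇c‖₂ ≤ ν·rate·sup|U⁗|`,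
`(∑‖∂ᵢ∂ₘc‖₂²)^{1/2} ≤ ν·rate·sup|U⁽⁵⁾|` requested by the line `lip-agmon`.

## Mathlib / tree search

Tree (reused): `Torus.partialDeriv_coordFun_self/_of_ne` (`TorusCoordinateFunctions`), `gradient_coordFun`,
`isSmooth_coordFun` (`SawtoothCascadeResponseVorticity`), `CascadeParams.torusVorticityTensor_field_of_mem_H/_V`,
`contDiff_deriv_U`, `deriv_U_periodic`, `deriv_deriv_U_periodic`, `abs_deriv_deriv_U_le`,
`abs_deriv3_U_le`, `abs_deriv4_U_le`. Searched `partialDeriv_partialDeriv_coordFun`, `vorticity_field.*partialDeriv`: nothing.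

## References

* T. M. Elgindi, K. Liss, J. C. Mattingly, arXiv:2304.05374, §1 (the pulsed shear profiles `H_α(x₂)`, `V_α(x₁)`). [ElgindiLissMattingly2025]
* G. B. Folland, *Real Analysis*, 2nd ed., Wiley 1999, §8.2. [Folland1999]
-/

noncomputable section

open MeasureTheory Set Filter Topology
open scoped ContDiff

namespace Literature.Analysis.FluidPDE.SawtoothCascade

open Literature.Analysis Literature.Analysis.FunctionSpaces

/-! ### §1 Profiles read on one coordinate: partial derivatives and their sizes -/

section CoordFun

variable {d : Type*} [Fintype d] [DecidableEq d]

/-- The derivative of a `1`-periodic function is `1`-periodic. [folklore] -/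
private theorem periodic_deriv' {f : ℝ → ℝ} (hf : Function.Periodic f 1) : Function.Periodic (deriv f) 1 := by
  intro s
  have h : (fun y => f (y + 1)) = f := funext hf
  rw [← deriv_comp_add_const, h]

/-- Partial derivatives of the zero function vanish. [folklore] -/
private theorem partialDeriv_zero_fun (i : d) :
    Torus.partialDeriv i (fun _ : UnitAddTorus d => (0 : ℝ)) = fun _ => 0 := by
  funext x
  have h := Torus.partialDeriv_coordFun_self (g := fun _ : ℝ => (0 : ℝ)) (fun _ => rfl) i x
  rw [deriv_const] at h
  exact h

/-- **`∂ₘ(ψ ∘ x_k) = 𝟙[m = k] · ψ′(x_k)`** as functions, for a `1`-periodic `ψ`. [cite: ElgindiLissMattingly2025, §1 (H_α(x₂), V_α(x₁) as fields on 𝕋²)] -/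
theorem partialDeriv_coordFun_eq {ψ : ℝ → ℝ} (hψ : Function.Periodic ψ 1) (k m : d) :
    Torus.partialDeriv m (fun x : UnitAddTorus d => ψ (Torus.repr x k)) =
      fun x => if m = k then deriv ψ (Torus.repr x k) else 0 := by
  funext x
  by_cases h : m = k
  · subst h
    rw [if_pos rfl, Torus.partialDeriv_coordFun_self hψ m x]
  · rw [if_neg h, Torus.partialDeriv_coordFun_of_ne hψ h x]

/-- **`∂ᵢ∂ₘ(ψ ∘ x_k) = 𝟙[i = k] 𝟙[m = k] · ψ″(x_k)`** as functions. [cite: ElgindiLissMattingly2025, §1 (H_α(x₂), V_α(x₁) as fields on 𝕋²)] -/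
theorem partialDeriv_partialDeriv_coordFun_eq {ψ : ℝ → ℝ} (hψ : Function.Periodic ψ 1) (k i m : d) :
    Torus.partialDeriv i (Torus.partialDeriv m (fun x : UnitAddTorus d => ψ (Torus.repr x k))) =
      fun x => if i = k ∧ m = k then deriv (deriv ψ) (Torus.repr x k) else 0 := by
  rw [partialDeriv_coordFun_eq hψ k m]
  by_cases hm : m = k
  · simp only [hm, if_true, and_true]
    exact partialDeriv_coordFun_eq (periodic_deriv' hψ) k i
  · simp only [hm, if_false, and_false]
    exact partialDeriv_zero_fun i

/-- **`∂ₗ∂ᵢ∂ₘ(ψ ∘ x_k) = 𝟙[l = i = m = k] · ψ‴(x_k)`** as functions. [cite: ElgindiLissMattingly2025, §1 (H_α(x₂), V_α(x₁) as fields on 𝕋²)] -/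
theorem partialDeriv3_coordFun_eq {ψ : ℝ → ℝ} (hψ : Function.Periodic ψ 1) (k l i m : d) :
    Torus.partialDeriv l (Torus.partialDeriv i (Torus.partialDeriv m (fun x : UnitAddTorus d => ψ (Torus.repr x k)))) =
      fun x => if l = k ∧ (i = k ∧ m = k) then deriv (deriv (deriv ψ)) (Torus.repr x k) else 0 := by
  rw [partialDeriv_partialDeriv_coordFun_eq hψ k i m]
  by_cases him : i = k ∧ m = k
  · simp only [him, if_true, and_true, and_self]
    exact partialDeriv_coordFun_eq (periodic_deriv' (periodic_deriv' hψ)) k l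
  · simp only [him, if_false, and_false]
    exact partialDeriv_zero_fun l

/-- `|∂ₘ(ψ ∘ x_k)(x)| ≤ sup|ψ′|`. [cite: ElgindiLissMattingly2025, §1 (H_α(x₂), V_α(x₁) as fields on 𝕋²)] -/
theorem abs_partialDeriv_coordFun_le {ψ : ℝ → ℝ} (hψ : Function.Periodic ψ 1) {A : ℝ} (hA : 0 ≤ A)
    (h1 : ∀ s, |deriv ψ s| ≤ A) (k m : d) (x : UnitAddTorus d) :
    |Torus.partialDeriv m (fun x : UnitAddTorus d => ψ (Torus.repr x k)) x| ≤ A := by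
  rw [partialDeriv_coordFun_eq hψ k m]
  by_cases h : m = k
  · simp only [h, if_true]; exact h1 _
  · simp only [h, if_false, abs_zero]; exact hA

/-- `|∂ᵢ∂ₘ(ψ ∘ x_k)(x)| ≤ sup|ψ″|`. [cite: ElgindiLissMattingly2025, §1 (H_α(x₂), V_α(x₁) as fields on 𝕋²)] -/
theorem abs_partialDeriv_partialDeriv_coordFun_le {ψ : ℝ → ℝ} (hψ : Function.Periodic ψ 1) {A : ℝ} (hA : 0 ≤ A)
    (h2 : ∀ s, |deriv (deriv ψ) s| ≤ A) (k i m : d) (x : UnitAddTorus d) :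
    |Torus.partialDeriv i (Torus.partialDeriv m (fun x : UnitAddTorus d => ψ (Torus.repr x k))) x| ≤ A := by
  rw [partialDeriv_partialDeriv_coordFun_eq hψ k i m]
  by_cases h : i = k ∧ m = k
  · simp only [h, if_true, and_self]; exact h2 _
  · simp only [h, if_false, abs_zero]; exact hA

/-- `|∂ₗ∂ᵢ∂ₘ(ψ ∘ x_k)(x)| ≤ sup|ψ‴|`. [cite: ElgindiLissMattingly2025, §1 (H_α(x₂), V_α(x₁) as fields on 𝕋²)] -/
theorem abs_partialDeriv3_coordFun_le {ψ : ℝ → ℝ} (hψ : Function.Periodic ψ 1) {A : ℝ} (hA : 0 ≤ A)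
    (h3 : ∀ s, |deriv (deriv (deriv ψ)) s| ≤ A) (k l i m : d) (x : UnitAddTorus d) :
    |Torus.partialDeriv l (Torus.partialDeriv i (Torus.partialDeriv m
      (fun x : UnitAddTorus d => ψ (Torus.repr x k)))) x| ≤ A := by
  rw [partialDeriv3_coordFun_eq hψ k l i m]
  by_cases h : l = k ∧ (i = k ∧ m = k)
  · simp only [h, if_true, and_self]; exact h3 _
  · simp only [h, if_false, abs_zero]; exact hA

omit [DecidableEq d] in
/-- An integral over the unit torus of a nonnegative function bounded by `C` is at most `C`
(no integrability needed). [folklore] -/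
private theorem integral_le_of_nonneg_of_le {f : UnitAddTorus d → ℝ} {C : ℝ} (h0 : ∀ x, 0 ≤ f x)
    (hle : ∀ x, f x ≤ C) : ∫ x, f x ≤ C := by
  have h := integral_mono_of_nonneg (μ := (volume : Measure (UnitAddTorus d))) (ae_of_all _ h0)
    (integrable_const C) (ae_of_all _ hle)
  simpa using h

/-- **`‖∇(ψ ∘ x_k)‖_{L²(T^d)} ≤ sup|ψ′|`** for a `C¹` `1`-periodic `ψ` (unit torus; `∇(ψ∘x_k) = ψ′(x_k) e_k`).
[cite: ElgindiLissMattingly2025, §1 (H_α(x₂), V_α(x₁) as fields on 𝕋²)] -/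
theorem sqrt_scalarGradNormSq_coordFun_le {ψ : ℝ → ℝ} (hψ : Function.Periodic ψ 1) (hs : ContDiff ℝ 1 ψ)
    {A : ℝ} (hA : 0 ≤ A) (h1 : ∀ s, |deriv ψ s| ≤ A) (k : d) :
    Real.sqrt (Torus.scalarGradNormSq (fun x : UnitAddTorus d => ψ (Torus.repr x k))) ≤ A := by
  have hn : ‖EuclideanSpace.single k (1 : ℝ)‖ = 1 := by simp
  have hpt : ∀ x : UnitAddTorus d, ‖Torus.gradient (fun x : UnitAddTorus d => ψ (Torus.repr x k)) x‖ ^ 2 =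
      (deriv ψ (Torus.repr x k)) ^ 2 := by
    intro x
    rw [gradient_coordFun hψ hs k x, norm_smul, hn, mul_one, Real.norm_eq_abs, sq_abs]
  have hI : Torus.scalarGradNormSq (fun x : UnitAddTorus d => ψ (Torus.repr x k)) ≤ A ^ 2 := by
    unfold Torus.scalarGradNormSq
    simp_rw [hpt]
    refine integral_le_of_nonneg_of_le (fun x => sq_nonneg _) fun x => ?_
    have := h1 (Torus.repr x k)
    rw [← sq_abs]
    exact pow_le_pow_left₀ (abs_nonneg _) this 2
  calc Real.sqrt (Torus.scalarGradNormSq (fun x : UnitAddTorus d => ψ (Torus.repr x k)))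
      ≤ Real.sqrt (A ^ 2) := Real.sqrt_le_sqrt hI
    _ = A := Real.sqrt_sq hA

/-- **`(∑ᵢₘ ‖∂ᵢ∂ₘ(ψ ∘ x_k)‖_{L²(T^d)}²)^{1/2} ≤ sup|ψ″|`** for a `1`-periodic `ψ` (only the `(k,k)` entry is
nonzero, and it is `ψ″(x_k)`). [cite: ElgindiLissMattingly2025, §1 (H_α(x₂), V_α(x₁) as fields on 𝕋²)] -/
theorem sqrt_sum_partialDeriv_partialDeriv_coordFun_sq_le {ψ : ℝ → ℝ} (hψ : Function.Periodic ψ 1)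
    {A : ℝ} (hA : 0 ≤ A) (h2 : ∀ s, |deriv (deriv ψ) s| ≤ A) (k : d) :
    Real.sqrt (∑ i, ∑ m, ∫ x, (Torus.partialDeriv i (Torus.partialDeriv m
      (fun x : UnitAddTorus d => ψ (Torus.repr x k))) x) ^ 2) ≤ A := by
  have hterm : ∀ i m, ∫ x, (Torus.partialDeriv i (Torus.partialDeriv m
      (fun x : UnitAddTorus d => ψ (Torus.repr x k))) x) ^ 2 =
      if i = k ∧ m = k then ∫ x : UnitAddTorus d, (deriv (deriv ψ) (Torus.repr x k)) ^ 2 else 0 := by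
    intro i m
    rw [partialDeriv_partialDeriv_coordFun_eq hψ k i m]
    by_cases h : i = k ∧ m = k
    · simp only [h, and_self, if_true]
    · simp only [h, if_false]
      simp
  simp_rw [hterm]
  have hsum : (∑ i : d, ∑ m : d, if i = k ∧ m = k then ∫ x : UnitAddTorus d, (deriv (deriv ψ) (Torus.repr x k)) ^ 2 else 0) =
      ∫ x : UnitAddTorus d, (deriv (deriv ψ) (Torus.repr x k)) ^ 2 := by
    rw [Finset.sum_eq_single k]
    · rw [Finset.sum_eq_single k]
      · simp
      · intro m _ hm; simp [hm]
      · intro hk; exact absurd (Finset.mem_univ k) hk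
    · intro i _ hi; simp [hi]
    · intro hk; exact absurd (Finset.mem_univ k) hk
  rw [hsum]
  have hI : ∫ x : UnitAddTorus d, (deriv (deriv ψ) (Torus.repr x k)) ^ 2 ≤ A ^ 2 := by
    refine integral_le_of_nonneg_of_le (fun x => sq_nonneg _) fun x => ?_
    rw [← sq_abs]
    exact pow_le_pow_left₀ (abs_nonneg _) (h2 _) 2
  calc Real.sqrt (∫ x : UnitAddTorus d, (deriv (deriv ψ) (Torus.repr x k)) ^ 2) ≤ Real.sqrt (A ^ 2) :=
        Real.sqrt_le_sqrt hI
    _ = A := Real.sqrt_sq hA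

end CoordFun

/-! ### §2 The cascade carrier vorticity on the half-slots: `|∂Ω̄|, |∂²Ω̄|, |∂³Ω̄|` -/

namespace CascadeParams

variable (P : CascadeParams)

/-- `U_j″` is `C^n` (`δ j > 0`). [cite: ElgindiLissMattingly2025, §1 (the smoothed pulse profiles)] -/
theorem contDiff_deriv2_U {j : ℕ} (hδ : 0 < P.δ j) {n : ℕ∞} : ContDiff ℝ n (deriv (deriv (P.U j))) := by
  have h : ContDiff ℝ ∞ (deriv (P.U j)) := P.contDiff_deriv_U hδ
  have h' : ContDiff ℝ ∞ (deriv (deriv (P.U j))) := (contDiff_infty_iff_deriv.1 h).2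
  exact h'.of_le (by exact_mod_cast le_top)

/-- `U_j‴` is `C^n` (`δ j > 0`). [cite: ElgindiLissMattingly2025, §1 (the smoothed pulse profiles)] -/
theorem contDiff_deriv3_U {j : ℕ} (hδ : 0 < P.δ j) {n : ℕ∞} : ContDiff ℝ n (deriv (deriv (deriv (P.U j)))) := by
  have h : ContDiff ℝ ∞ (deriv (deriv (P.U j))) := P.contDiff_deriv2_U hδ
  have h' : ContDiff ℝ ∞ (deriv (deriv (deriv (P.U j)))) := (contDiff_infty_iff_deriv.1 h).2
  exact h'.of_le (by exact_mod_cast le_top)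

/-- Derivatives of the slot profile `s ↦ c · U_j′(s)`: first. [cite: ElgindiLissMattingly2025, §1 (the smoothed pulse profiles)] -/
theorem deriv_const_mul_deriv_U {j : ℕ} (hδ : 0 < P.δ j) (c : ℝ) :
    deriv (fun s => c * deriv (P.U j) s) = fun s => c * deriv (deriv (P.U j)) s := by
  funext s
  have hd : DifferentiableAt ℝ (deriv (P.U j)) s :=
    ((P.contDiff_deriv_U hδ (n := 1)).differentiable (by norm_num)).differentiableAt
  exact (hd.hasDerivAt.const_mul c).deriv

/-- Derivatives of the slot profile: second. [cite: ElgindiLissMattingly2025, §1 (the smoothed pulse profiles)] -/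
theorem deriv2_const_mul_deriv_U {j : ℕ} (hδ : 0 < P.δ j) (c : ℝ) :
    deriv (deriv (fun s => c * deriv (P.U j) s)) = fun s => c * deriv (deriv (deriv (P.U j))) s := by
  rw [P.deriv_const_mul_deriv_U hδ c]
  funext s
  have hd : DifferentiableAt ℝ (deriv (deriv (P.U j))) s :=
    ((P.contDiff_deriv2_U hδ (n := 1)).differentiable (by norm_num)).differentiableAt
  exact (hd.hasDerivAt.const_mul c).deriv

/-- Derivatives of the slot profile: third. [cite: ElgindiLissMattingly2025, §1 (the smoothed pulse profiles)] -/
theorem deriv3_const_mul_deriv_U {j : ℕ} (hδ : 0 < P.δ j) (c : ℝ) :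
    deriv (deriv (deriv (fun s => c * deriv (P.U j) s))) = fun s => c * deriv (deriv (deriv (deriv (P.U j)))) s := by
  rw [P.deriv2_const_mul_deriv_U hδ c]
  funext s
  have hd : DifferentiableAt ℝ (deriv (deriv (deriv (P.U j)))) s :=
    ((P.contDiff_deriv3_U hδ (n := 1)).differentiable (by norm_num)).differentiableAt
  exact (hd.hasDerivAt.const_mul c).deriv

/-- The slot profile `s ↦ c · U_j′(s)` is `1`-periodic. [cite: ElgindiLissMattingly2025, §1 (H_α, V_α on 𝕋²)] -/
theorem periodic_const_mul_deriv_U (j : ℕ) (c : ℝ) : Function.Periodic (fun s => c * deriv (P.U j) s) 1 :=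
  fun s => by simp only [P.deriv_U_periodic j s]

/-- **Carrier vorticity on an H half-slot as a one-coordinate profile**:
`Ω̄(t, ·) = (s ↦ −rateH j t · U_j′(s)) ∘ x₂`. [cite: ElgindiLissMattingly2025, §1 (u_α = H_α(x₂) e₁ on its half period)] -/
theorem vorticity_field_eq_coordFun_of_mem_H {j : ℕ} {t : ℝ} (ht : t ∈ Icc (tStart j) (tStart j + tHalf j)) :
    torusVorticityTensor (P.field t) 0 1 =
      fun y => (fun s => -P.rateH j t * deriv (P.U j) s) (Torus.repr y 1) := by
  funext y
  rw [P.torusVorticityTensor_field_of_mem_H ht y]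
  ring

/-- **Carrier vorticity on a V half-slot as a one-coordinate profile**:
`Ω̄(t, ·) = (s ↦ rateV j t · U_j′(s)) ∘ x₁`. [cite: ElgindiLissMattingly2025, §1 (u_α = V_α(x₁) e₂ on its half period)] -/
theorem vorticity_field_eq_coordFun_of_mem_V {j : ℕ} {t : ℝ} (ht : t ∈ Icc (tStart j + tHalf j) (tStart (j + 1))) :
    torusVorticityTensor (P.field t) 0 1 =
      fun y => (fun s => P.rateV j t * deriv (P.U j) s) (Torus.repr y 0) := by
  funext y
  rw [P.torusVorticityTensor_field_of_mem_V ht y]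

/-- **First-derivative cap of the carrier vorticity (H half-slot)**: `|∂ₘΩ̄(t, x)| ≤ |rateH j t| · 2√(2π)N_j/δ_j`.
[cite: ElgindiLissMattingly2025, §1 and Rmk. 1.4 (the smoothed pulse profiles)] -/
theorem abs_partialDeriv_vorticity_field_le_of_mem_H {j : ℕ} (hδ : 0 < P.δ j) {t : ℝ}
    (ht : t ∈ Icc (tStart j) (tStart j + tHalf j)) (x : UnitAddTorus (Fin 2)) (m : Fin 2) :
    |Torus.partialDeriv m (torusVorticityTensor (P.field t) 0 1) x| ≤
      |P.rateH j t| * (2 * Real.sqrt (2 * Real.pi) * P.N j / P.δ j) := by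
  rw [P.vorticity_field_eq_coordFun_of_mem_H ht]
  refine abs_partialDeriv_coordFun_le (P.periodic_const_mul_deriv_U j _) (by positivity) (fun s => ?_) 1 m x
  rw [P.deriv_const_mul_deriv_U hδ, abs_mul, abs_neg]
  exact mul_le_mul_of_nonneg_left (P.abs_deriv_deriv_U_le hδ s) (abs_nonneg _)

/-- **Second-derivative cap of the carrier vorticity (H half-slot)**: `|∂ᵢ∂ₘΩ̄(t, x)| ≤ |rateH j t| · 2(2πN_j)²/δ_j²`.
[cite: ElgindiLissMattingly2025, §1 and Rmk. 1.4 (the smoothed pulse profiles)] -/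
theorem abs_partialDeriv2_vorticity_field_le_of_mem_H {j : ℕ} (hδ : 0 < P.δ j) {t : ℝ}
    (ht : t ∈ Icc (tStart j) (tStart j + tHalf j)) (x : UnitAddTorus (Fin 2)) (i m : Fin 2) :
    |Torus.partialDeriv i (Torus.partialDeriv m (torusVorticityTensor (P.field t) 0 1)) x| ≤
      |P.rateH j t| * (2 * (2 * Real.pi * P.N j) ^ 2 / P.δ j ^ 2) := by
  rw [P.vorticity_field_eq_coordFun_of_mem_H ht]
  refine abs_partialDeriv_partialDeriv_coordFun_le (P.periodic_const_mul_deriv_U j _) (by positivity)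
    (fun s => ?_) 1 i m x
  rw [P.deriv2_const_mul_deriv_U hδ, abs_mul, abs_neg]
  exact mul_le_mul_of_nonneg_left (P.abs_deriv3_U_le hδ s) (abs_nonneg _)

/-- **Third-derivative cap of the carrier vorticity (H half-slot)**:
`|∂ₗ∂ᵢ∂ₘΩ̄(t, x)| ≤ |rateH j t| · 10(2πN_j)³/(δ_j³√(2π))`. [cite: ElgindiLissMattingly2025, §1 and Rmk. 1.4 (the smoothed pulse profiles)] -/
theorem abs_partialDeriv3_vorticity_field_le_of_mem_H {j : ℕ} (hδ : 0 < P.δ j) {t : ℝ}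
    (ht : t ∈ Icc (tStart j) (tStart j + tHalf j)) (x : UnitAddTorus (Fin 2)) (l i m : Fin 2) :
    |Torus.partialDeriv l (Torus.partialDeriv i (Torus.partialDeriv m (torusVorticityTensor (P.field t) 0 1))) x| ≤
      |P.rateH j t| * (10 * (2 * Real.pi * P.N j) ^ 3 / (P.δ j ^ 3 * Real.sqrt (2 * Real.pi))) := by
  rw [P.vorticity_field_eq_coordFun_of_mem_H ht]
  refine abs_partialDeriv3_coordFun_le (P.periodic_const_mul_deriv_U j _) (by positivity)
    (fun s => ?_) 1 l i m x
  rw [P.deriv3_const_mul_deriv_U hδ, abs_mul, abs_neg]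
  exact mul_le_mul_of_nonneg_left (P.abs_deriv4_U_le hδ s) (abs_nonneg _)

/-- **First-derivative cap of the carrier vorticity (V half-slot)**: `|∂ₘΩ̄(t, x)| ≤ |rateV j t| · 2√(2π)N_j/δ_j`.
[cite: ElgindiLissMattingly2025, §1 and Rmk. 1.4 (the smoothed pulse profiles)] -/
theorem abs_partialDeriv_vorticity_field_le_of_mem_V {j : ℕ} (hδ : 0 < P.δ j) {t : ℝ}
    (ht : t ∈ Icc (tStart j + tHalf j) (tStart (j + 1))) (x : UnitAddTorus (Fin 2)) (m : Fin 2) :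
    |Torus.partialDeriv m (torusVorticityTensor (P.field t) 0 1) x| ≤
      |P.rateV j t| * (2 * Real.sqrt (2 * Real.pi) * P.N j / P.δ j) := by
  rw [P.vorticity_field_eq_coordFun_of_mem_V ht]
  refine abs_partialDeriv_coordFun_le (P.periodic_const_mul_deriv_U j _) (by positivity) (fun s => ?_) 0 m x
  rw [P.deriv_const_mul_deriv_U hδ, abs_mul]
  exact mul_le_mul_of_nonneg_left (P.abs_deriv_deriv_U_le hδ s) (abs_nonneg _)

/-- **Second-derivative cap of the carrier vorticity (V half-slot)**: `|∂ᵢ∂ₘΩ̄(t, x)| ≤ |rateV j t| · 2(2πN_j)²/δ_j²`.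
[cite: ElgindiLissMattingly2025, §1 and Rmk. 1.4 (the smoothed pulse profiles)] -/
theorem abs_partialDeriv2_vorticity_field_le_of_mem_V {j : ℕ} (hδ : 0 < P.δ j) {t : ℝ}
    (ht : t ∈ Icc (tStart j + tHalf j) (tStart (j + 1))) (x : UnitAddTorus (Fin 2)) (i m : Fin 2) :
    |Torus.partialDeriv i (Torus.partialDeriv m (torusVorticityTensor (P.field t) 0 1)) x| ≤
      |P.rateV j t| * (2 * (2 * Real.pi * P.N j) ^ 2 / P.δ j ^ 2) := by
  rw [P.vorticity_field_eq_coordFun_of_mem_V ht]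
  refine abs_partialDeriv_partialDeriv_coordFun_le (P.periodic_const_mul_deriv_U j _) (by positivity)
    (fun s => ?_) 0 i m x
  rw [P.deriv2_const_mul_deriv_U hδ, abs_mul]
  exact mul_le_mul_of_nonneg_left (P.abs_deriv3_U_le hδ s) (abs_nonneg _)

/-- **Third-derivative cap of the carrier vorticity (V half-slot)**:
`|∂ₗ∂ᵢ∂ₘΩ̄(t, x)| ≤ |rateV j t| · 10(2πN_j)³/(δ_j³√(2π))`. [cite: ElgindiLissMattingly2025, §1 and Rmk. 1.4 (the smoothed pulse profiles)] -/
theorem abs_partialDeriv3_vorticity_field_le_of_mem_V {j : ℕ} (hδ : 0 < P.δ j) {t : ℝ}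
    (ht : t ∈ Icc (tStart j + tHalf j) (tStart (j + 1))) (x : UnitAddTorus (Fin 2)) (l i m : Fin 2) :
    |Torus.partialDeriv l (Torus.partialDeriv i (Torus.partialDeriv m (torusVorticityTensor (P.field t) 0 1))) x| ≤
      |P.rateV j t| * (10 * (2 * Real.pi * P.N j) ^ 3 / (P.δ j ^ 3 * Real.sqrt (2 * Real.pi))) := by
  rw [P.vorticity_field_eq_coordFun_of_mem_V ht]
  refine abs_partialDeriv3_coordFun_le (P.periodic_const_mul_deriv_U j _) (by positivity)
    (fun s => ?_) 0 l i m x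
  rw [P.deriv3_const_mul_deriv_U hδ, abs_mul]
  exact mul_le_mul_of_nonneg_left (P.abs_deriv4_U_le hδ s) (abs_nonneg _)

/-! ### §3 The viscous force profile `c = κ · U_j‴(x_k)`: `‖∇c‖₂`, `(∑‖∂ᵢ∂ₘc‖₂²)^{1/2}` -/

/-- **`‖∇(κ·U_j‴ ∘ x_k)‖₂ ≤ |κ| · 10(2πN_j)³/(δ_j³√(2π))`** on the unit torus (any `κ`, e.g. `κ = −ν·rate`).
[cite: ElgindiLissMattingly2025, §1 and Rmk. 1.4 (the smoothed pulse profiles)] -/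
theorem sqrt_scalarGradNormSq_deriv3_U_coordFun_le {d : Type*} [Fintype d] [DecidableEq d] {j : ℕ}
    (hδ : 0 < P.δ j) (κ : ℝ) (k : d) :
    Real.sqrt (Torus.scalarGradNormSq (fun x : UnitAddTorus d => κ * deriv (deriv (deriv (P.U j))) (Torus.repr x k))) ≤
      |κ| * (10 * (2 * Real.pi * P.N j) ^ 3 / (P.δ j ^ 3 * Real.sqrt (2 * Real.pi))) := by
  have hper : Function.Periodic (fun s => κ * deriv (deriv (deriv (P.U j))) s) 1 := fun s => by
    simp only [periodic_deriv' (P.deriv_deriv_U_periodic j) s]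
  have hs : ContDiff ℝ 1 (fun s => κ * deriv (deriv (deriv (P.U j))) s) :=
    contDiff_const.mul (P.contDiff_deriv3_U hδ)
  refine sqrt_scalarGradNormSq_coordFun_le hper hs (by positivity) (fun s => ?_) k
  have hd : DifferentiableAt ℝ (deriv (deriv (deriv (P.U j)))) s :=
    ((P.contDiff_deriv3_U hδ (n := 1)).differentiable (by norm_num)).differentiableAt
  rw [(hd.hasDerivAt.const_mul κ).deriv, abs_mul]
  exact mul_le_mul_of_nonneg_left (P.abs_deriv4_U_le hδ s) (abs_nonneg _)

/-- `U_j⁗` is `C^n` (`δ j > 0`). [cite: ElgindiLissMattingly2025, §1 (the smoothed pulse profiles)] -/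
theorem contDiff_deriv4_U {j : ℕ} (hδ : 0 < P.δ j) {n : ℕ∞} :
    ContDiff ℝ n (deriv (deriv (deriv (deriv (P.U j))))) := by
  have h : ContDiff ℝ ∞ (deriv (deriv (deriv (P.U j)))) := P.contDiff_deriv3_U hδ
  have h' : ContDiff ℝ ∞ (deriv (deriv (deriv (deriv (P.U j))))) := (contDiff_infty_iff_deriv.1 h).2
  exact h'.of_le (by exact_mod_cast le_top)

/-- **`(∑ᵢₘ‖∂ᵢ∂ₘ(κ·U_j‴ ∘ x_k)‖₂²)^{1/2} ≤ |κ| · 12(2πN_j)⁴/δ_j⁴`** on the unit torus.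
[cite: ElgindiLissMattingly2025, §1 and Rmk. 1.4 (the smoothed pulse profiles)] -/
theorem sqrt_sum_partialDeriv_partialDeriv_deriv3_U_coordFun_sq_le {d : Type*} [Fintype d] [DecidableEq d]
    {j : ℕ} (hδ : 0 < P.δ j) (κ : ℝ) (k : d) :
    Real.sqrt (∑ i, ∑ m, ∫ x, (Torus.partialDeriv i (Torus.partialDeriv m
      (fun x : UnitAddTorus d => κ * deriv (deriv (deriv (P.U j))) (Torus.repr x k))) x) ^ 2) ≤
      |κ| * (12 * (2 * Real.pi * P.N j) ^ 4 / P.δ j ^ 4) := by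
  have hper : Function.Periodic (fun s => κ * deriv (deriv (deriv (P.U j))) s) 1 := fun s => by
    simp only [periodic_deriv' (P.deriv_deriv_U_periodic j) s]
  refine sqrt_sum_partialDeriv_partialDeriv_coordFun_sq_le hper (by positivity) (fun s => ?_) k
  have e1 : deriv (fun s => κ * deriv (deriv (deriv (P.U j))) s) = fun s => κ * deriv (deriv (deriv (deriv (P.U j)))) s := by
    funext s
    have hd : DifferentiableAt ℝ (deriv (deriv (deriv (P.U j)))) s :=
      ((P.contDiff_deriv3_U hδ (n := 1)).differentiable (by norm_num)).differentiableAt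
    exact (hd.hasDerivAt.const_mul κ).deriv
  rw [e1]
  have hd : DifferentiableAt ℝ (deriv (deriv (deriv (deriv (P.U j))))) s :=
    ((P.contDiff_deriv4_U hδ (n := 1)).differentiable (by norm_num)).differentiableAt
  rw [(hd.hasDerivAt.const_mul κ).deriv, abs_mul]
  exact mul_le_mul_of_nonneg_left (P.abs_deriv5_U_le hδ s) (abs_nonneg _)

/-! ### §4 (AMENDMENT 1) The viscous force `g = ν Δū` on the half-slots and its vorticity `c = ∂₀g₁ − ∂₁g₀` -/

/-- Partial derivatives of the zero vector field vanish. [folklore] -/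
private theorem partialDeriv_zero_vec (i : Fin 2) :
    Torus.partialDeriv i (fun _ : UnitAddTorus (Fin 2) => (0 : EuclideanSpace ℝ (Fin 2))) = fun _ => 0 := by
  funext x
  have h := Torus.partialDeriv_coordFun_self (g := fun _ : ℝ => (0 : EuclideanSpace ℝ (Fin 2))) (fun _ => rfl) i x
  rw [deriv_const] at h
  exact h

/-- The H half-slot field as a one-coordinate profile: `ū(t, x) = (rateH j t · U_j(x₂)) e₁`.
[cite: ElgindiLissMattingly2025, §1 (u_α = H_α(x₂) e₁ on its half period)] -/
theorem field_eq_coordFun_of_mem_H {j : ℕ} {t : ℝ} (ht : t ∈ Icc (tStart j) (tStart j + tHalf j)) :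
    P.field t = fun x => (fun s => (P.rateH j t * P.U j s) • EuclideanSpace.single (0 : Fin 2) (1 : ℝ))
      (Torus.repr x 1) := by
  funext x
  rw [P.field_eq_of_mem_H ht x]
  ext i
  fin_cases i <;> simp

/-- The V half-slot field as a one-coordinate profile: `ū(t, x) = (rateV j t · U_j(x₁)) e₂`.
[cite: ElgindiLissMattingly2025, §1 (u_α = V_α(x₁) e₂ on its half period)] -/
theorem field_eq_coordFun_of_mem_V {j : ℕ} {t : ℝ} (ht : t ∈ Icc (tStart j + tHalf j) (tStart (j + 1))) :
    P.field t = fun x => (fun s => (P.rateV j t * P.U j s) • EuclideanSpace.single (1 : Fin 2) (1 : ℝ))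
      (Torus.repr x 0) := by
  funext x
  rw [P.field_eq_of_mem_V ht x]
  ext i
  fin_cases i <;> simp

/-- Derivative of the vector profile `s ↦ (c · U_j⁽ⁿ⁾(s)) e`: one more derivative on the scalar factor.
[cite: ElgindiLissMattingly2025, §1 (the smoothed pulse profiles)] -/
theorem deriv_smul_single_profile {φ : ℝ → ℝ} (hφ : Differentiable ℝ φ) (c : ℝ) (e : EuclideanSpace ℝ (Fin 2)) :
    deriv (fun s => (c * φ s) • e) = fun s => (c * deriv φ s) • e := by
  funext s
  exact (((hφ s).hasDerivAt.const_mul c).smul_const e).deriv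

/-- **Laplacian of the carrier on an H half-slot**: `Δū(t, x) = (rateH j t · U_j″(x₂)) e₁` (`δ j > 0`).
[cite: ElgindiLissMattingly2025, §1 (u_α = H_α(x₂) e₁ on its half period)] -/
theorem laplacian_field_of_mem_H {j : ℕ} (hδ : 0 < P.δ j) {t : ℝ} (ht : t ∈ Icc (tStart j) (tStart j + tHalf j)) :
    Torus.laplacian (P.field t) =
      fun x => (P.rateH j t * deriv (deriv (P.U j)) (Torus.repr x 1)) • EuclideanSpace.single (0 : Fin 2) (1 : ℝ) := by
  set Φ : ℝ → EuclideanSpace ℝ (Fin 2) :=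
    fun s => (P.rateH j t * P.U j s) • EuclideanSpace.single (0 : Fin 2) (1 : ℝ) with hΦ
  have hper : Function.Periodic Φ 1 := fun s => by simp only [hΦ, P.U_periodic j s]
  have hUd : Differentiable ℝ (P.U j) := (P.contDiff_U hδ (n := 1)).differentiable (by norm_num)
  have hU1d : Differentiable ℝ (deriv (P.U j)) := (P.contDiff_deriv_U hδ (n := 1)).differentiable (by norm_num)
  have hΦs : ContDiff ℝ ∞ Φ := (contDiff_const.mul (P.contDiff_U hδ)).smul contDiff_const
  have hfield : P.field t = fun x => Φ (Torus.repr x 1) := P.field_eq_coordFun_of_mem_H ht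
  have hsm : Torus.IsSmooth (P.field t) := by rw [hfield]; exact isSmooth_coordFun hper hΦs 1
  have hdΦ : deriv Φ = fun s => (P.rateH j t * deriv (P.U j) s) • EuclideanSpace.single (0 : Fin 2) (1 : ℝ) :=
    deriv_smul_single_profile hUd _ _
  have hper1 : Function.Periodic (deriv Φ) 1 := fun s => by simp only [hdΦ, P.deriv_U_periodic j s]
  have hddΦ : deriv (deriv Φ) =
      fun s => (P.rateH j t * deriv (deriv (P.U j)) s) • EuclideanSpace.single (0 : Fin 2) (1 : ℝ) := by
    rw [hdΦ]; exact deriv_smul_single_profile hU1d _ _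
  have h0 : Torus.partialDeriv 0 (P.field t) = fun _ => 0 := by
    funext x; rw [hfield]; exact Torus.partialDeriv_coordFun_of_ne hper (by decide) x
  have h1 : Torus.partialDeriv 1 (P.field t) = fun x => deriv Φ (Torus.repr x 1) := by
    funext x; rw [hfield]; exact Torus.partialDeriv_coordFun_self hper 1 x
  funext x
  rw [Torus.laplacian_eq_sum_partialDeriv_partialDeriv hsm x, Fin.sum_univ_two, h0, h1, partialDeriv_zero_vec,
    Torus.partialDeriv_coordFun_self hper1 1 x, hddΦ]
  simp

/-- **Laplacian of the carrier on a V half-slot**: `Δū(t, x) = (rateV j t · U_j″(x₁)) e₂` (`δ j > 0`).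
[cite: ElgindiLissMattingly2025, §1 (u_α = V_α(x₁) e₂ on its half period)] -/
theorem laplacian_field_of_mem_V {j : ℕ} (hδ : 0 < P.δ j) {t : ℝ}
    (ht : t ∈ Icc (tStart j + tHalf j) (tStart (j + 1))) :
    Torus.laplacian (P.field t) =
      fun x => (P.rateV j t * deriv (deriv (P.U j)) (Torus.repr x 0)) • EuclideanSpace.single (1 : Fin 2) (1 : ℝ) := by
  set Φ : ℝ → EuclideanSpace ℝ (Fin 2) :=
    fun s => (P.rateV j t * P.U j s) • EuclideanSpace.single (1 : Fin 2) (1 : ℝ) with hΦ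
  have hper : Function.Periodic Φ 1 := fun s => by simp only [hΦ, P.U_periodic j s]
  have hUd : Differentiable ℝ (P.U j) := (P.contDiff_U hδ (n := 1)).differentiable (by norm_num)
  have hU1d : Differentiable ℝ (deriv (P.U j)) := (P.contDiff_deriv_U hδ (n := 1)).differentiable (by norm_num)
  have hΦs : ContDiff ℝ ∞ Φ := (contDiff_const.mul (P.contDiff_U hδ)).smul contDiff_const
  have hfield : P.field t = fun x => Φ (Torus.repr x 0) := P.field_eq_coordFun_of_mem_V ht
  have hsm : Torus.IsSmooth (P.field t) := by rw [hfield]; exact isSmooth_coordFun hper hΦs 0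
  have hdΦ : deriv Φ = fun s => (P.rateV j t * deriv (P.U j) s) • EuclideanSpace.single (1 : Fin 2) (1 : ℝ) :=
    deriv_smul_single_profile hUd _ _
  have hper1 : Function.Periodic (deriv Φ) 1 := fun s => by simp only [hdΦ, P.deriv_U_periodic j s]
  have hddΦ : deriv (deriv Φ) =
      fun s => (P.rateV j t * deriv (deriv (P.U j)) s) • EuclideanSpace.single (1 : Fin 2) (1 : ℝ) := by
    rw [hdΦ]; exact deriv_smul_single_profile hU1d _ _
  have h1 : Torus.partialDeriv 1 (P.field t) = fun _ => 0 := by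
    funext x; rw [hfield]; exact Torus.partialDeriv_coordFun_of_ne hper (by decide) x
  have h0 : Torus.partialDeriv 0 (P.field t) = fun x => deriv Φ (Torus.repr x 0) := by
    funext x; rw [hfield]; exact Torus.partialDeriv_coordFun_self hper 0 x
  funext x
  rw [Torus.laplacian_eq_sum_partialDeriv_partialDeriv hsm x, Fin.sum_univ_two, h0, h1, partialDeriv_zero_vec,
    Torus.partialDeriv_coordFun_self hper1 0 x, hddΦ]
  simp

/-- **Vorticity of the viscous force on an H half-slot**: for `g = ν Δū`,
`c = ∂₀g₁ − ∂₁g₀ = −ν · rateH j t · U_j‴(x₂)`, i.e. `c = (κ · U_j‴) ∘ x₂` with `κ = −ν·rateH j t`.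
[cite: ElgindiLissMattingly2025, §1 (u_α = H_α(x₂) e₁ on its half period)] -/
theorem vorticity_viscousForce_eq_coordFun_of_mem_H {j : ℕ} (hδ : 0 < P.δ j) {t : ℝ}
    (ht : t ∈ Icc (tStart j) (tStart j + tHalf j)) (ν : ℝ) :
    torusVorticityTensor (fun x => ν • Torus.laplacian (P.field t) x) 0 1 =
      fun x => (-(ν * P.rateH j t)) * deriv (deriv (deriv (P.U j))) (Torus.repr x 1) := by
  set Ψ : ℝ → EuclideanSpace ℝ (Fin 2) :=
    fun s => ((ν * P.rateH j t) * deriv (deriv (P.U j)) s) • EuclideanSpace.single (0 : Fin 2) (1 : ℝ) with hΨ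
  have hg : (fun x => ν • Torus.laplacian (P.field t) x) = fun x => Ψ (Torus.repr x 1) := by
    funext x
    rw [P.laplacian_field_of_mem_H hδ ht]
    simp only [hΨ, smul_smul]
    ring_nf
  have hper : Function.Periodic Ψ 1 := fun s => by simp only [hΨ, P.deriv_deriv_U_periodic j s]
  have hU2d : Differentiable ℝ (deriv (deriv (P.U j))) :=
    (P.contDiff_deriv2_U hδ (n := 1)).differentiable (by norm_num)
  have hdΨ : deriv Ψ = fun s => ((ν * P.rateH j t) * deriv (deriv (deriv (P.U j))) s) •
      EuclideanSpace.single (0 : Fin 2) (1 : ℝ) := deriv_smul_single_profile hU2d _ _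
  funext x
  rw [torusVorticityTensor, hg, Torus.partialDeriv_coordFun_of_ne hper (by decide) x,
    Torus.partialDeriv_coordFun_self hper 1 x, hdΨ]
  simp

/-- **Vorticity of the viscous force on a V half-slot**: for `g = ν Δū`,
`c = ∂₀g₁ − ∂₁g₀ = ν · rateV j t · U_j‴(x₁)`, i.e. `c = (κ · U_j‴) ∘ x₁` with `κ = ν·rateV j t`.
[cite: ElgindiLissMattingly2025, §1 (u_α = V_α(x₁) e₂ on its half period)] -/
theorem vorticity_viscousForce_eq_coordFun_of_mem_V {j : ℕ} (hδ : 0 < P.δ j) {t : ℝ}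
    (ht : t ∈ Icc (tStart j + tHalf j) (tStart (j + 1))) (ν : ℝ) :
    torusVorticityTensor (fun x => ν • Torus.laplacian (P.field t) x) 0 1 =
      fun x => (ν * P.rateV j t) * deriv (deriv (deriv (P.U j))) (Torus.repr x 0) := by
  set Ψ : ℝ → EuclideanSpace ℝ (Fin 2) :=
    fun s => ((ν * P.rateV j t) * deriv (deriv (P.U j)) s) • EuclideanSpace.single (1 : Fin 2) (1 : ℝ) with hΨ
  have hg : (fun x => ν • Torus.laplacian (P.field t) x) = fun x => Ψ (Torus.repr x 0) := by
    funext x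
    rw [P.laplacian_field_of_mem_V hδ ht]
    simp only [hΨ, smul_smul]
    ring_nf
  have hper : Function.Periodic Ψ 1 := fun s => by simp only [hΨ, P.deriv_deriv_U_periodic j s]
  have hU2d : Differentiable ℝ (deriv (deriv (P.U j))) :=
    (P.contDiff_deriv2_U hδ (n := 1)).differentiable (by norm_num)
  have hdΨ : deriv Ψ = fun s => ((ν * P.rateV j t) * deriv (deriv (deriv (P.U j))) s) •
      EuclideanSpace.single (1 : Fin 2) (1 : ℝ) := deriv_smul_single_profile hU2d _ _
  funext x
  rw [torusVorticityTensor, hg, Torus.partialDeriv_coordFun_self hper 0 x,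
    Torus.partialDeriv_coordFun_of_ne hper (by decide) x, hdΨ]
  simp

/-- **Force-vorticity sizes on an H half-slot**: with `c = ∂₀g₁ − ∂₁g₀`, `g = ν Δū`,
`‖∇c‖₂ ≤ |ν·rateH j t| · 10(2πN_j)³/(δ_j³√(2π))` and `(∑‖∂ᵢ∂ₘc‖₂²)^{1/2} ≤ |ν·rateH j t| · 12(2πN_j)⁴/δ_j⁴`.
[cite: ElgindiLissMattingly2025, §1 and Rmk. 1.4 (the smoothed pulse profiles)] -/
theorem vorticity_viscousForce_sizes_of_mem_H {j : ℕ} (hδ : 0 < P.δ j) {t : ℝ}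
    (ht : t ∈ Icc (tStart j) (tStart j + tHalf j)) (ν : ℝ) :
    Real.sqrt (Torus.scalarGradNormSq (torusVorticityTensor (fun x => ν • Torus.laplacian (P.field t) x) 0 1)) ≤
        |ν * P.rateH j t| * (10 * (2 * Real.pi * P.N j) ^ 3 / (P.δ j ^ 3 * Real.sqrt (2 * Real.pi))) ∧
      Real.sqrt (∑ i, ∑ m, ∫ x, (Torus.partialDeriv i (Torus.partialDeriv m
        (torusVorticityTensor (fun x => ν • Torus.laplacian (P.field t) x) 0 1)) x) ^ 2) ≤
        |ν * P.rateH j t| * (12 * (2 * Real.pi * P.N j) ^ 4 / P.δ j ^ 4) := by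
  rw [P.vorticity_viscousForce_eq_coordFun_of_mem_H hδ ht ν]
  refine ⟨?_, ?_⟩
  · have h := P.sqrt_scalarGradNormSq_deriv3_U_coordFun_le hδ (-(ν * P.rateH j t)) (1 : Fin 2)
    rwa [abs_neg] at h
  · have h := P.sqrt_sum_partialDeriv_partialDeriv_deriv3_U_coordFun_sq_le hδ (-(ν * P.rateH j t)) (1 : Fin 2)
    rwa [abs_neg] at h

/-- **Force-vorticity sizes on a V half-slot** (as on H, with `x₁`, `rateV`).
[cite: ElgindiLissMattingly2025, §1 and Rmk. 1.4 (the smoothed pulse profiles)] -/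
theorem vorticity_viscousForce_sizes_of_mem_V {j : ℕ} (hδ : 0 < P.δ j) {t : ℝ}
    (ht : t ∈ Icc (tStart j + tHalf j) (tStart (j + 1))) (ν : ℝ) :
    Real.sqrt (Torus.scalarGradNormSq (torusVorticityTensor (fun x => ν • Torus.laplacian (P.field t) x) 0 1)) ≤
        |ν * P.rateV j t| * (10 * (2 * Real.pi * P.N j) ^ 3 / (P.δ j ^ 3 * Real.sqrt (2 * Real.pi))) ∧
      Real.sqrt (∑ i, ∑ m, ∫ x, (Torus.partialDeriv i (Torus.partialDeriv m
        (torusVorticityTensor (fun x => ν • Torus.laplacian (P.field t) x) 0 1)) x) ^ 2) ≤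
        |ν * P.rateV j t| * (12 * (2 * Real.pi * P.N j) ^ 4 / P.δ j ^ 4) := by
  rw [P.vorticity_viscousForce_eq_coordFun_of_mem_V hδ ht ν]
  exact ⟨P.sqrt_scalarGradNormSq_deriv3_U_coordFun_le hδ _ (0 : Fin 2),
    P.sqrt_sum_partialDeriv_partialDeriv_deriv3_U_coordFun_sq_le hδ _ (0 : Fin 2)⟩

/-! ### §5 (AMENDMENT 2) Smoothness in `x` of `ū(t,·)`, `Ω̄(t,·)`, `Δū(t,·)` and of the force vorticity on the half-slots -/

/-- On an H half-slot, `ū(t, ·)` is smooth on `𝕋²` (`δ j > 0`). [cite: ElgindiLissMattingly2025, §1 (u_α = H_α(x₂) e₁ on its half period)] -/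
theorem isSmooth_field_of_mem_H {j : ℕ} (hδ : 0 < P.δ j) {t : ℝ} (ht : t ∈ Icc (tStart j) (tStart j + tHalf j)) :
    Torus.IsSmooth (P.field t) := by
  set Φ : ℝ → EuclideanSpace ℝ (Fin 2) :=
    fun s => (P.rateH j t * P.U j s) • EuclideanSpace.single (0 : Fin 2) (1 : ℝ) with hΦ
  have hper : Function.Periodic Φ 1 := fun s => by simp only [hΦ, P.U_periodic j s]
  have hΦs : ContDiff ℝ ∞ Φ := (contDiff_const.mul (P.contDiff_U hδ)).smul contDiff_const
  rw [P.field_eq_coordFun_of_mem_H ht]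
  exact isSmooth_coordFun hper hΦs 1

/-- On a V half-slot, `ū(t, ·)` is smooth on `𝕋²` (`δ j > 0`). [cite: ElgindiLissMattingly2025, §1 (u_α = V_α(x₁) e₂ on its half period)] -/
theorem isSmooth_field_of_mem_V {j : ℕ} (hδ : 0 < P.δ j) {t : ℝ}
    (ht : t ∈ Icc (tStart j + tHalf j) (tStart (j + 1))) : Torus.IsSmooth (P.field t) := by
  set Φ : ℝ → EuclideanSpace ℝ (Fin 2) :=
    fun s => (P.rateV j t * P.U j s) • EuclideanSpace.single (1 : Fin 2) (1 : ℝ) with hΦ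
  have hper : Function.Periodic Φ 1 := fun s => by simp only [hΦ, P.U_periodic j s]
  have hΦs : ContDiff ℝ ∞ Φ := (contDiff_const.mul (P.contDiff_U hδ)).smul contDiff_const
  rw [P.field_eq_coordFun_of_mem_V ht]
  exact isSmooth_coordFun hper hΦs 0

/-- On an H half-slot, the carrier vorticity `Ω̄(t, ·)` is smooth on `𝕋²`. [cite: ElgindiLissMattingly2025, §1 (u_α = H_α(x₂) e₁ on its half period)] -/
theorem isSmooth_vorticity_field_of_mem_H {j : ℕ} (hδ : 0 < P.δ j) {t : ℝ}
    (ht : t ∈ Icc (tStart j) (tStart j + tHalf j)) : Torus.IsSmooth (torusVorticityTensor (P.field t) 0 1) := by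
  rw [P.vorticity_field_eq_coordFun_of_mem_H ht]
  exact isSmooth_coordFun (P.periodic_const_mul_deriv_U j _) (contDiff_const.mul (P.contDiff_deriv_U hδ)) 1

/-- On a V half-slot, the carrier vorticity `Ω̄(t, ·)` is smooth on `𝕋²`. [cite: ElgindiLissMattingly2025, §1 (u_α = V_α(x₁) e₂ on its half period)] -/
theorem isSmooth_vorticity_field_of_mem_V {j : ℕ} (hδ : 0 < P.δ j) {t : ℝ}
    (ht : t ∈ Icc (tStart j + tHalf j) (tStart (j + 1))) : Torus.IsSmooth (torusVorticityTensor (P.field t) 0 1) := by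
  rw [P.vorticity_field_eq_coordFun_of_mem_V ht]
  exact isSmooth_coordFun (P.periodic_const_mul_deriv_U j _) (contDiff_const.mul (P.contDiff_deriv_U hδ)) 0

/-- On an H half-slot, the viscous force `ν Δū(t, ·)` is smooth on `𝕋²`. [cite: ElgindiLissMattingly2025, §1 (u_α = H_α(x₂) e₁ on its half period)] -/
theorem isSmooth_viscousForce_of_mem_H {j : ℕ} (hδ : 0 < P.δ j) {t : ℝ}
    (ht : t ∈ Icc (tStart j) (tStart j + tHalf j)) (ν : ℝ) :
    Torus.IsSmooth (fun x => ν • Torus.laplacian (P.field t) x) := by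
  set Ψ : ℝ → EuclideanSpace ℝ (Fin 2) :=
    fun s => ((ν * P.rateH j t) * deriv (deriv (P.U j)) s) • EuclideanSpace.single (0 : Fin 2) (1 : ℝ) with hΨ
  have hg : (fun x => ν • Torus.laplacian (P.field t) x) = fun x => Ψ (Torus.repr x 1) := by
    funext x
    rw [P.laplacian_field_of_mem_H hδ ht]
    simp only [hΨ, smul_smul]
    ring_nf
  have hper : Function.Periodic Ψ 1 := fun s => by simp only [hΨ, P.deriv_deriv_U_periodic j s]
  have hΨs : ContDiff ℝ ∞ Ψ := (contDiff_const.mul (P.contDiff_deriv2_U hδ)).smul contDiff_const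
  rw [hg]
  exact isSmooth_coordFun hper hΨs 1

/-- On a V half-slot, the viscous force `ν Δū(t, ·)` is smooth on `𝕋²`. [cite: ElgindiLissMattingly2025, §1 (u_α = V_α(x₁) e₂ on its half period)] -/
theorem isSmooth_viscousForce_of_mem_V {j : ℕ} (hδ : 0 < P.δ j) {t : ℝ}
    (ht : t ∈ Icc (tStart j + tHalf j) (tStart (j + 1))) (ν : ℝ) :
    Torus.IsSmooth (fun x => ν • Torus.laplacian (P.field t) x) := by
  set Ψ : ℝ → EuclideanSpace ℝ (Fin 2) :=
    fun s => ((ν * P.rateV j t) * deriv (deriv (P.U j)) s) • EuclideanSpace.single (1 : Fin 2) (1 : ℝ) with hΨ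
  have hg : (fun x => ν • Torus.laplacian (P.field t) x) = fun x => Ψ (Torus.repr x 0) := by
    funext x
    rw [P.laplacian_field_of_mem_V hδ ht]
    simp only [hΨ, smul_smul]
    ring_nf
  have hper : Function.Periodic Ψ 1 := fun s => by simp only [hΨ, P.deriv_deriv_U_periodic j s]
  have hΨs : ContDiff ℝ ∞ Ψ := (contDiff_const.mul (P.contDiff_deriv2_U hδ)).smul contDiff_const
  rw [hg]
  exact isSmooth_coordFun hper hΨs 0

/-- On an H half-slot, the force vorticity `c = ∂₀g₁ − ∂₁g₀` (`g = ν Δū`) is smooth on `𝕋²`.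
[cite: ElgindiLissMattingly2025, §1 (u_α = H_α(x₂) e₁ on its half period)] -/
theorem isSmooth_vorticity_viscousForce_of_mem_H {j : ℕ} (hδ : 0 < P.δ j) {t : ℝ}
    (ht : t ∈ Icc (tStart j) (tStart j + tHalf j)) (ν : ℝ) :
    Torus.IsSmooth (torusVorticityTensor (fun x => ν • Torus.laplacian (P.field t) x) 0 1) := by
  rw [P.vorticity_viscousForce_eq_coordFun_of_mem_H hδ ht ν]
  refine isSmooth_coordFun (fun s => ?_) (contDiff_const.mul (P.contDiff_deriv3_U hδ)) 1
  simp only [periodic_deriv' (P.deriv_deriv_U_periodic j) s]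

/-- On a V half-slot, the force vorticity `c = ∂₀g₁ − ∂₁g₀` (`g = ν Δū`) is smooth on `𝕋²`.
[cite: ElgindiLissMattingly2025, §1 (u_α = V_α(x₁) e₂ on its half period)] -/
theorem isSmooth_vorticity_viscousForce_of_mem_V {j : ℕ} (hδ : 0 < P.δ j) {t : ℝ}
    (ht : t ∈ Icc (tStart j + tHalf j) (tStart (j + 1))) (ν : ℝ) :
    Torus.IsSmooth (torusVorticityTensor (fun x => ν • Torus.laplacian (P.field t) x) 0 1) := by
  rw [P.vorticity_viscousForce_eq_coordFun_of_mem_V hδ ht ν]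
  refine isSmooth_coordFun (fun s => ?_) (contDiff_const.mul (P.contDiff_deriv3_U hδ)) 0
  simp only [periodic_deriv' (P.deriv_deriv_U_periodic j) s]

/-! ### §6 (AMENDMENT 3) The carrier's velocity-gradient caps on the half-slots: `‖∂ₖū‖ ≤ |rate|`, `‖∂ᵢ∂ₖū‖ ≤ |rate|·2√(2π)N_j/δ_j` -/

/-- `‖c • e_k‖ = |c|` for the standard basis vectors of `ℝ²`. [folklore] -/
private theorem norm_smul_single (c : ℝ) (k : Fin 2) : ‖c • EuclideanSpace.single k (1 : ℝ)‖ = |c| := by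
  have hn : ‖EuclideanSpace.single k (1 : ℝ)‖ = 1 := by simp
  rw [norm_smul, hn, mul_one, Real.norm_eq_abs]

/-- **First derivatives of the carrier (H half-slot)** as functions: `∂₀ū = 0`, `∂₁ū = (rateH·U_j′(x₂)) e₁`.
[cite: ElgindiLissMattingly2025, §1 (u_α = H_α(x₂) e₁ on its half period)] -/
theorem partialDeriv_field_eq_of_mem_H {j : ℕ} (hδ : 0 < P.δ j) {t : ℝ} (ht : t ∈ Icc (tStart j) (tStart j + tHalf j))
    (k : Fin 2) :
    Torus.partialDeriv k (P.field t) = fun x =>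
      if k = 1 then (P.rateH j t * deriv (P.U j) (Torus.repr x 1)) • EuclideanSpace.single (0 : Fin 2) (1 : ℝ) else 0 := by
  set Φ : ℝ → EuclideanSpace ℝ (Fin 2) :=
    fun s => (P.rateH j t * P.U j s) • EuclideanSpace.single (0 : Fin 2) (1 : ℝ) with hΦ
  have hper : Function.Periodic Φ 1 := fun s => by simp only [hΦ, P.U_periodic j s]
  have hUd : Differentiable ℝ (P.U j) := (P.contDiff_U hδ (n := 1)).differentiable (by norm_num)
  have hdΦ : deriv Φ = fun s => (P.rateH j t * deriv (P.U j) s) • EuclideanSpace.single (0 : Fin 2) (1 : ℝ) :=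
    deriv_smul_single_profile hUd _ _
  have hfield : P.field t = fun x => Φ (Torus.repr x 1) := P.field_eq_coordFun_of_mem_H ht
  funext x
  rw [hfield]
  by_cases hk : k = 1
  · subst hk
    rw [if_pos rfl, Torus.partialDeriv_coordFun_self hper 1 x, hdΦ]
  · rw [if_neg hk, Torus.partialDeriv_coordFun_of_ne hper hk x]

/-- **First derivatives of the carrier (V half-slot)** as functions: `∂₁ū = 0`, `∂₀ū = (rateV·U_j′(x₁)) e₂`.
[cite: ElgindiLissMattingly2025, §1 (u_α = V_α(x₁) e₂ on its half period)] -/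
theorem partialDeriv_field_eq_of_mem_V {j : ℕ} (hδ : 0 < P.δ j) {t : ℝ}
    (ht : t ∈ Icc (tStart j + tHalf j) (tStart (j + 1))) (k : Fin 2) :
    Torus.partialDeriv k (P.field t) = fun x =>
      if k = 0 then (P.rateV j t * deriv (P.U j) (Torus.repr x 0)) • EuclideanSpace.single (1 : Fin 2) (1 : ℝ) else 0 := by
  set Φ : ℝ → EuclideanSpace ℝ (Fin 2) :=
    fun s => (P.rateV j t * P.U j s) • EuclideanSpace.single (1 : Fin 2) (1 : ℝ) with hΦ
  have hper : Function.Periodic Φ 1 := fun s => by simp only [hΦ, P.U_periodic j s]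
  have hUd : Differentiable ℝ (P.U j) := (P.contDiff_U hδ (n := 1)).differentiable (by norm_num)
  have hdΦ : deriv Φ = fun s => (P.rateV j t * deriv (P.U j) s) • EuclideanSpace.single (1 : Fin 2) (1 : ℝ) :=
    deriv_smul_single_profile hUd _ _
  have hfield : P.field t = fun x => Φ (Torus.repr x 0) := P.field_eq_coordFun_of_mem_V ht
  funext x
  rw [hfield]
  by_cases hk : k = 0
  · subst hk
    rw [if_pos rfl, Torus.partialDeriv_coordFun_self hper 0 x, hdΦ]
  · rw [if_neg hk, Torus.partialDeriv_coordFun_of_ne hper hk x]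

/-- **Velocity-gradient cap of the carrier (H half-slot)**: `‖∂ₖū(t, x)‖ ≤ |rateH j t|` (`|U_j′| ≤ 1`).
This is the `Λ` of `TorusLinearisedNSVorticityGradientGrowth` on the slot.
[cite: ElgindiLissMattingly2025, §1 and Rmk. 1.4 (the smoothed pulse profiles)] -/
theorem norm_partialDeriv_field_le_of_mem_H {j : ℕ} (hδ : 0 < P.δ j) {t : ℝ}
    (ht : t ∈ Icc (tStart j) (tStart j + tHalf j)) (x : UnitAddTorus (Fin 2)) (k : Fin 2) :
    ‖Torus.partialDeriv k (P.field t) x‖ ≤ |P.rateH j t| := by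
  rw [P.partialDeriv_field_eq_of_mem_H hδ ht k]
  by_cases hk : k = 1
  · simp only [hk, if_true]
    rw [norm_smul_single, abs_mul]
    calc |P.rateH j t| * |deriv (P.U j) (Torus.repr x 1)| ≤ |P.rateH j t| * 1 :=
          mul_le_mul_of_nonneg_left (P.abs_deriv_U_le_one hδ _) (abs_nonneg _)
      _ = |P.rateH j t| := mul_one _
  · simp only [hk, if_false, norm_zero]
    exact abs_nonneg _

/-- **Velocity-gradient cap of the carrier (V half-slot)**: `‖∂ₖū(t, x)‖ ≤ |rateV j t|`.
[cite: ElgindiLissMattingly2025, §1 and Rmk. 1.4 (the smoothed pulse profiles)] -/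
theorem norm_partialDeriv_field_le_of_mem_V {j : ℕ} (hδ : 0 < P.δ j) {t : ℝ}
    (ht : t ∈ Icc (tStart j + tHalf j) (tStart (j + 1))) (x : UnitAddTorus (Fin 2)) (k : Fin 2) :
    ‖Torus.partialDeriv k (P.field t) x‖ ≤ |P.rateV j t| := by
  rw [P.partialDeriv_field_eq_of_mem_V hδ ht k]
  by_cases hk : k = 0
  · simp only [hk, if_true]
    rw [norm_smul_single, abs_mul]
    calc |P.rateV j t| * |deriv (P.U j) (Torus.repr x 0)| ≤ |P.rateV j t| * 1 :=
          mul_le_mul_of_nonneg_left (P.abs_deriv_U_le_one hδ _) (abs_nonneg _)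
      _ = |P.rateV j t| := mul_one _
  · simp only [hk, if_false, norm_zero]
    exact abs_nonneg _

/-- **Second derivatives of the carrier (H half-slot)** as functions: `∂ᵢ∂ₖū = 𝟙[i = k = 1] (rateH·U_j″(x₂)) e₁`.
[cite: ElgindiLissMattingly2025, §1 (u_α = H_α(x₂) e₁ on its half period)] -/
theorem partialDeriv_partialDeriv_field_eq_of_mem_H {j : ℕ} (hδ : 0 < P.δ j) {t : ℝ}
    (ht : t ∈ Icc (tStart j) (tStart j + tHalf j)) (i k : Fin 2) :
    Torus.partialDeriv i (Torus.partialDeriv k (P.field t)) = fun x =>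
      if i = 1 ∧ k = 1 then (P.rateH j t * deriv (deriv (P.U j)) (Torus.repr x 1)) •
        EuclideanSpace.single (0 : Fin 2) (1 : ℝ) else 0 := by
  rw [P.partialDeriv_field_eq_of_mem_H hδ ht k]
  by_cases hk : k = 1
  · simp only [hk, if_true, and_true]
    set Φ₁ : ℝ → EuclideanSpace ℝ (Fin 2) :=
      fun s => (P.rateH j t * deriv (P.U j) s) • EuclideanSpace.single (0 : Fin 2) (1 : ℝ) with hΦ₁
    have hper : Function.Periodic Φ₁ 1 := fun s => by simp only [hΦ₁, P.deriv_U_periodic j s]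
    have hU1d : Differentiable ℝ (deriv (P.U j)) := (P.contDiff_deriv_U hδ (n := 1)).differentiable (by norm_num)
    have hdΦ₁ : deriv Φ₁ = fun s => (P.rateH j t * deriv (deriv (P.U j)) s) • EuclideanSpace.single (0 : Fin 2) (1 : ℝ) :=
      deriv_smul_single_profile hU1d _ _
    have hf : (fun x : UnitAddTorus (Fin 2) => (P.rateH j t * deriv (P.U j) (Torus.repr x 1)) •
        EuclideanSpace.single (0 : Fin 2) (1 : ℝ)) = fun x => Φ₁ (Torus.repr x 1) := rfl
    rw [hf]
    funext x
    by_cases hi : i = 1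
    · subst hi
      rw [if_pos rfl, Torus.partialDeriv_coordFun_self hper 1 x, hdΦ₁]
    · rw [if_neg hi, Torus.partialDeriv_coordFun_of_ne hper hi x]
  · simp only [hk, if_false, and_false]
    exact partialDeriv_zero_vec i

/-- **Second derivatives of the carrier (V half-slot)** as functions: `∂ᵢ∂ₖū = 𝟙[i = k = 0] (rateV·U_j″(x₁)) e₂`.
[cite: ElgindiLissMattingly2025, §1 (u_α = V_α(x₁) e₂ on its half period)] -/
theorem partialDeriv_partialDeriv_field_eq_of_mem_V {j : ℕ} (hδ : 0 < P.δ j) {t : ℝ}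
    (ht : t ∈ Icc (tStart j + tHalf j) (tStart (j + 1))) (i k : Fin 2) :
    Torus.partialDeriv i (Torus.partialDeriv k (P.field t)) = fun x =>
      if i = 0 ∧ k = 0 then (P.rateV j t * deriv (deriv (P.U j)) (Torus.repr x 0)) •
        EuclideanSpace.single (1 : Fin 2) (1 : ℝ) else 0 := by
  rw [P.partialDeriv_field_eq_of_mem_V hδ ht k]
  by_cases hk : k = 0
  · simp only [hk, if_true, and_true]
    set Φ₁ : ℝ → EuclideanSpace ℝ (Fin 2) :=
      fun s => (P.rateV j t * deriv (P.U j) s) • EuclideanSpace.single (1 : Fin 2) (1 : ℝ) with hΦ₁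
    have hper : Function.Periodic Φ₁ 1 := fun s => by simp only [hΦ₁, P.deriv_U_periodic j s]
    have hU1d : Differentiable ℝ (deriv (P.U j)) := (P.contDiff_deriv_U hδ (n := 1)).differentiable (by norm_num)
    have hdΦ₁ : deriv Φ₁ = fun s => (P.rateV j t * deriv (deriv (P.U j)) s) • EuclideanSpace.single (1 : Fin 2) (1 : ℝ) :=
      deriv_smul_single_profile hU1d _ _
    have hf : (fun x : UnitAddTorus (Fin 2) => (P.rateV j t * deriv (P.U j) (Torus.repr x 0)) •
        EuclideanSpace.single (1 : Fin 2) (1 : ℝ)) = fun x => Φ₁ (Torus.repr x 0) := rfl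
    rw [hf]
    funext x
    by_cases hi : i = 0
    · subst hi
      rw [if_pos rfl, Torus.partialDeriv_coordFun_self hper 0 x, hdΦ₁]
    · rw [if_neg hi, Torus.partialDeriv_coordFun_of_ne hper hi x]
  · simp only [hk, if_false, and_false]
    exact partialDeriv_zero_vec i

/-- **Velocity-Hessian cap of the carrier (H half-slot)**: `‖∂ᵢ∂ₖū(t, x)‖ ≤ |rateH j t| · 2√(2π)N_j/δ_j`.
This is the `L₂` of `TorusLinearisedNSVorticityGradientGrowth` on the slot.
[cite: ElgindiLissMattingly2025, §1 and Rmk. 1.4 (the smoothed pulse profiles)] -/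
theorem norm_partialDeriv_partialDeriv_field_le_of_mem_H {j : ℕ} (hδ : 0 < P.δ j) {t : ℝ}
    (ht : t ∈ Icc (tStart j) (tStart j + tHalf j)) (x : UnitAddTorus (Fin 2)) (i k : Fin 2) :
    ‖Torus.partialDeriv i (Torus.partialDeriv k (P.field t)) x‖ ≤
      |P.rateH j t| * (2 * Real.sqrt (2 * Real.pi) * P.N j / P.δ j) := by
  rw [P.partialDeriv_partialDeriv_field_eq_of_mem_H hδ ht i k]
  by_cases h : i = 1 ∧ k = 1
  · simp only [h, and_self, if_true]
    rw [norm_smul_single, abs_mul]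
    exact mul_le_mul_of_nonneg_left (P.abs_deriv_deriv_U_le hδ _) (abs_nonneg _)
  · simp only [h, if_false, norm_zero]
    positivity

/-- **Velocity-Hessian cap of the carrier (V half-slot)**: `‖∂ᵢ∂ₖū(t, x)‖ ≤ |rateV j t| · 2√(2π)N_j/δ_j`.
[cite: ElgindiLissMattingly2025, §1 and Rmk. 1.4 (the smoothed pulse profiles)] -/
theorem norm_partialDeriv_partialDeriv_field_le_of_mem_V {j : ℕ} (hδ : 0 < P.δ j) {t : ℝ}
    (ht : t ∈ Icc (tStart j + tHalf j) (tStart (j + 1))) (x : UnitAddTorus (Fin 2)) (i k : Fin 2) :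
    ‖Torus.partialDeriv i (Torus.partialDeriv k (P.field t)) x‖ ≤
      |P.rateV j t| * (2 * Real.sqrt (2 * Real.pi) * P.N j / P.δ j) := by
  rw [P.partialDeriv_partialDeriv_field_eq_of_mem_V hδ ht i k]
  by_cases h : i = 0 ∧ k = 0
  · simp only [h, and_self, if_true]
    rw [norm_smul_single, abs_mul]
    exact mul_le_mul_of_nonneg_left (P.abs_deriv_deriv_U_le hδ _) (abs_nonneg _)
  · simp only [h, if_false, norm_zero]
    positivity

end CascadeParams

end Literature.Analysis.FluidPDE.SawtoothCascade

end
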